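import Summits.AtomisticToContinuum.Crystallization.Theses.BenjaminiSchrammPeriodicSupport
import Summits.AtomisticToContinuum.Crystallization.Theorems.IsometryAtomsPeriodicSupportToHinge

/-!
# Route `BenjaminiSchrammPeriodicSupport`, item stmt-AtomisticToContinuum-12748 `SupportToHinge`

The glue `SupportToHinge := PeriodicSupport → BenjaminiSchrammLimit (written out) → CrysEnergyLimit →
GroundStatesChargePeriodic` of route `BenjaminiSchrammPeriodicSupport` is, after unfolding its three
named antecedents / consequent, literally the statement `IsometryAtoms.PeriodicSupportToHinge`
(stmt-AtomisticToContinuum-15779, whose Theses decl inlines them), proved as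
`Summit.AtomisticToContinuum.Crystallization.Theorems.periodicSupportToHinge_proof`
(module `…Theorems.IsometryAtomsPeriodicSupportToHinge`: portmanteau / density transfer at radius
`R + ε/2`, tolerance `ε/2`; window transfer + density hand-over). This thin wrapper closes the twin.
References: D. Aldous, R. Lyons, EJP 12 (2007) §2 [AldousLyons2007]; D. Aldous, J. M. Steele,
*The objective method* (2004) [AldousSteele2004].
-/

namespace Summit.AtomisticToContinuum.Crystallization.Theorems

/-- **Item `stmt-AtomisticToContinuum-12748` for route `BenjaminiSchrammPeriodicSupport`**: the glue
`SupportToHinge` (periodic support of minimising point-stationary hard-core laws ⇒ the finite-`N`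
hinge `GroundStatesChargePeriodic`, given the Benjamini–Schramm limit with density transfer and
`E(N)/N → e*`), by `periodicSupportToHinge_proof` — the same proposition once `PeriodicSupport`,
`CrysEnergyLimit` and `GroundStatesChargePeriodic` are unfolded. -/
theorem supportToHinge_proof :
    Summit.AtomisticToContinuum.Crystallization.Theses.BenjaminiSchrammPeriodicSupport.SupportToHinge := by
  unfold Summit.AtomisticToContinuum.Crystallization.Theses.BenjaminiSchrammPeriodicSupport.SupportToHinge
    Summit.AtomisticToContinuum.Crystallization.Theses.BenjaminiSchrammPeriodicSupport.PeriodicSupport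
    Summit.AtomisticToContinuum.Crystallization.Theses.BenjaminiSchrammPeriodicSupport.CrysEnergyLimit
    Summit.AtomisticToContinuum.Crystallization.Theses.BenjaminiSchrammPeriodicSupport.GroundStatesChargePeriodic
  exact periodicSupportToHinge_proof

end Summit.AtomisticToContinuum.Crystallization.Theorems
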